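import Summits.HodgeConjecture.HodgeConjecture.Theorems.R90S6UnitaryTwoTreeRegular          -- ★ this seat (REG2 F2 p865221): `finite_neighborSet_latticeTree_two`, `ncard_neighborSet_latticeTree_two_eq`
import Literature.NumberTheory.Automorphic.UnitaryGroupIntegralPointsReductionInert             -- ★ §3: `mem_integer_galAdicCompletionMap`, `exists_residueField_ringHom_galAdicCompletionMap`, `residueHom_galAdicCompletionMap_eq_pow`, `natCard_residueField_eq_sq_of_inert`
import Literature.NumberTheory.Automorphic.UnitaryGroupInertPlaceHyperbolicBasis               -- ★ `galAdicCompletionMap_galAdicCompletionMap_of_smul_eq` (`σ_w` is an involution)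
import Literature.NumberTheory.LocalFields.UnramifiedQuadraticNormAtInertPlace                  -- ★ `exists_isUnit_map_sub_of_residueHom_ne` (the unit mover `a₀`)
import Literature.LinearAlgebra.Matrix.FiniteFieldHermitianAnisotropic                          -- ★ `exists_frob_ne` (`Frob_q ≠ id` on `𝔽_{q²}`)
import Literature.NumberTheory.Automorphic.HermitianLatticeTreeTransitive                       -- ★ `forall_isSelfDualLattice_exists_latt_eq_of_isUnit_sub` (transitivity `hA` over a local field)
import Literature.NumberTheory.Automorphic.AdicCompletionLocalField                             -- ★ `IsNonarchimedeanLocalField (w.adicCompletion E)`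
import HarnessLib

/-!
# R90 · S6 — CARD «REG2», FILE 3 «AT THE PLACE»: at an INERT place `w ∣ v` of a quadratic extension `E ∕ F` of number fields the tree `X₂(E_w)` of `U(1,1)_w` is
# `(q_v+1)`-regular and locally finite — every REG2 letter discharged (`Theorems/R90S6UnitaryTwoTreeRegularCM.lean`)

Cell `hodgecm-mathlib`, crux H413 (`stmt-HodgeConjecture-24833`), route of record `HCCMUnconditional`; programme R90-TF, section S6 (base `R90-C14`), seat
R90-C14-p03 (g3); card «REG2 FILE 3» (dealer R90-C14-plan (g3), R90 bus 2026-09-05T03:51Z; consumers: the G5 assembler of `StubR90ExtE1HeckeFLOneFrame` (D :989) ∕ K2E3-p34's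
`h_REG2`, G1 (p02), G2, FIN).  Helper lane `--supports stmt-HodgeConjecture-24833 --as helper`; THEOREMS ONLY (no definition, no instance, no notation, no named fact, no `sorry`).

SETTING (the generic inert place of ★ `UnitaryLatticeTreeValencyInertPlace` §3 ∕ ★ `UnitaryGroupIntegralPointsReductionInert` §3; the CM socket is the instance
`F := L⁺`, `E := L`, `c := complexConj`): `E ∕ F` quadratic, `c ∈ Gal(E ∕ F)`, `c ≠ 1`, `v` a finite place of `F` UNRAMIFIED in `E`, `w ∣ v` with `c • w = w` (inert),
`E_w = w.1.adicCompletion E` (both `Valued … ℤᵐ⁰` and `ValuativeRel`, compatible), `σ_w = galAdicCompletionMap c hw`, ANY `ϖ` with `hd : UnramifiedLocalConjDatum σ_w ϖ`,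
`J₂ = (StdForm.antidiagonal 2).over E_w`, `X₂ = latticeTree σ_w ϖ J₂`, `q_v = |𝓞_F ∕ 𝔭_v|`.

THE LETTERS OF ★ REG2 F2, PAID AT THE PLACE (§1): `σO := σ_w|_𝒪` (★ `mem_integer_galAdicCompletionMap`, `hσO'` by `rfl`), `σO ∘ σO = id`
(★ `galAdicCompletionMap_galAdicCompletionMap_of_smul_eq`), its reduction `σk` (★ `exists_residueField_ringHom_galAdicCompletionMap`), `|𝓀[E_w]| = q_v²`
(★ `natCard_residueField_eq_sq_of_inert`), the unit mover `a₀` (★ `exists_isUnit_map_sub_of_residueHom_ne` ∘ ★ `exists_frob_ne` ∘ ★ `residueHom_galAdicCompletionMap_eq_pow`: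
`σk = Frob_{q_v} ≠ id`), and TRANSITIVITY **`forall_isSelfDualLattice_exists_latt_eq_inert`** — every self-dual lattice of `(E_w², J₂)` is `u·𝒪²`, `u ∈ U₂` (★
`forall_isSelfDualLattice_exists_latt_eq_of_isUnit_sub` over the local field `E_w`, ★ `AdicCompletionLocalField`) = the binder `hA` of ★ H2 ∕ H2-NUMBERS ∕ A1-H ∕ REG2 F2.
THE HEADS (§2): **`finite_neighborSet_latticeTree_two_inert`** (`hloc` at the place) and **`ncard_neighborSet_latticeTree_two_eq_inert : #N(x) = q_v + 1`** (`hreg ∕ hdeg` at the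
place), for every vertex `x` of `X₂(E_w)` and every datum-carrying uniformiser `ϖ`.
HONEST LABEL: the inert-place dress of a regularity letter; proves no printed global statement, discharges no citation; count-neutral helper.
HC_CM is proved only modulo the 7 printed citations (2 remaining named inputs: hLiu418 = stmt-HodgeConjecture-24832, h413 = stmt-HodgeConjecture-24833) until rung 0 closes; REL ≠ ★ ≠ BUILT.

## References
* [Serre1980Trees] J.-P. Serre, *Trees* (1980): II.1.1 (the tree of a rank-one group over a local field; every vertex has `q + 1` neighbours).
* [BruhatTits1972] F. Bruhat, J. Tits, *Groupes réductifs sur un corps local I*, Publ. Math. IHÉS 41 (1972): §10.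
* [NeukirchANT1999] J. Neukirch, *Algebraic Number Theory* (1999): Ch. II §4 Prop. (4.3) (unramified extensions of local fields; Frobenius; `|𝓞∕𝔓| = q^f`).
* [Jacobowitz1962] R. Jacobowitz, *Hermitian forms over local fields*, Amer. J. Math. 84 (1962): §7 Thm. 7.1 (unimodular hermitian lattices over an unramified extension are isometric).
* [Serre1979] J.-P. Serre, *Local Fields*, GTM 67 (1979): Ch. V §2 (unramified quadratic extensions).
-/

set_option autoImplicit false
-- the mandated namespace repeats the single-problem summit's segment (`HodgeConjecture.HodgeConjecture`)
set_option linter.dupNamespace false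

noncomputable section

open Set Function NumberField IsDedekindDomain
open scoped ValuativeRel Matrix MatrixGroups
open SimpleGraph Matrix ValuativeRel
open Literature.NumberTheory.Automorphic Literature.NumberTheory.Automorphic.UnitaryGroup
open Literature.NumberTheory.Automorphic.HermitianLatticeTree
open Literature.Combinatorics.SimpleGraph

namespace Summit.HodgeConjecture.HodgeConjecture.R90.S6

section InertPlace

variable {F E : Type} [Field F] [NumberField F] [Field E] [NumberField E] [Algebra F E] [Algebra.IsQuadraticExtension F E]
  (c : E ≃ₐ[F] E) (hc : c ≠ 1) (v : HeightOneSpectrum (𝓞 F)) (w : PlacesOver E v) (hw : c • w.1 = w.1) (hv : Algebra.IsUnramifiedIn (𝓞 E) v.asIdeal)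

/-! ## §1 Transitivity on the self-dual vertices at the place (the binder `hA`) -/

include hc hv in
/-- **`hA` AT AN INERT PLACE — `U(σ_w, J₂)(E_w)` IS TRANSITIVE ON THE SELF-DUAL LATTICES of `(E_w², J₂)`**: every self-dual `M` is `latt ↑u` for some `u ∈ U₂` (★
`forall_isSelfDualLattice_exists_latt_eq_of_isUnit_sub` over the non-archimedean local field `E_w`: `σ_w` an involution preserving `𝒪_w` whose reduction is `Frob_{q_v} ≠ id`,
so some integer is moved by a unit; `J₂ = antidiag(1,1) ∈ GL₂(𝒪_w)` is `σ_w`-hermitian).  The binder `hA` of ★ H2 ∕ H2-NUMBERS ∕ A1-H ∕ REG2 F2, for every `ϖ`.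
[cite: Jacobowitz1962, §7 Thm. 7.1] [cite: NeukirchANT1999, Ch. II §4 Prop. (4.3)] -/
theorem forall_isSelfDualLattice_exists_latt_eq_inert :
    ∀ M : Submodule 𝒪[w.1.adicCompletion E] (Fin 2 → w.1.adicCompletion E),
      IsSelfDualLattice (galAdicCompletionMap (L := E) c hw) ((StdForm.antidiagonal 2).over (w.1.adicCompletion E)) M →
        ∃ u : unitaryGroupOfForm (galAdicCompletionMap (L := E) c hw) ((StdForm.antidiagonal 2).over (w.1.adicCompletion E)),
          latt (((u : GL (Fin 2) (w.1.adicCompletion E))) : Matrix (Fin 2) (Fin 2) (w.1.adicCompletion E)) = M := by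
  have hσO : ∀ x : 𝒪[w.1.adicCompletion E], galAdicCompletionMap (L := E) c hw x ∈ 𝒪[w.1.adicCompletion E] := mem_integer_galAdicCompletionMap c v w hw
  have hσσ : ∀ x : w.1.adicCompletion E, galAdicCompletionMap (L := E) c hw (galAdicCompletionMap (L := E) c hw x) = x :=
    fun x => galAdicCompletionMap_galAdicCompletionMap_of_smul_eq c w hc hw x
  obtain ⟨σk, hσk⟩ := exists_residueField_ringHom_galAdicCompletionMap c v w hw
  letI : Fintype 𝓀[w.1.adicCompletion E] := Fintype.ofFinite _
  have hq' : Fintype.card 𝓀[w.1.adicCompletion E] = Nat.card (𝓞 F ⧸ v.asIdeal) ^ 2 := by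
    rw [← Nat.card_eq_fintype_card]; exact natCard_residueField_eq_sq_of_inert c v hc hv w hw
  obtain ⟨a₀, ha₀⟩ := Literature.NumberTheory.LocalFields.UnramifiedQuadraticNorm.exists_isUnit_map_sub_of_residueHom_ne (galAdicCompletionMap (L := E) c hw) hσO σk hσk
    (Literature.LinearAlgebra.Matrix.exists_frob_ne hq' σk (residueHom_galAdicCompletionMap_eq_pow c v hc hv w hw σk hσO hσk))
  -- the form `J₂` as an element of `GL₂(𝒪_w)`, `σ_w`-hermitian
  have hJdet : ((StdForm.antidiagonal 2).over (w.1.adicCompletion E)).det ≠ 0 := by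
    rw [UnitaryGroup.Two.antidiagonal_two_over_eq, Matrix.det_fin_two_of]; simp
  let H : GL (Fin 2) (w.1.adicCompletion E) := Matrix.GeneralLinearGroup.mkOfDetNeZero _ hJdet
  have hH : (H : Matrix (Fin 2) (Fin 2) (w.1.adicCompletion E)) = (StdForm.antidiagonal 2).over (w.1.adicCompletion E) := rfl
  have hHK : H ∈ glInt 2 (w.1.adicCompletion E) := mem_glInt_of_coe_eq_antidiag H (by rw [hH, UnitaryGroup.Two.antidiagonal_two_over_eq])
  have hHh : ((H : Matrix (Fin 2) (Fin 2) (w.1.adicCompletion E)).map (galAdicCompletionMap (L := E) c hw))ᵀ = H := by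
    rw [hH, UnitaryGroup.Two.antidiagonal_two_over_eq]
    ext i j; fin_cases i <;> fin_cases j <;> simp
  intro M hM
  exact forall_isSelfDualLattice_exists_latt_eq_of_isUnit_sub (galAdicCompletionMap (L := E) c hw) hσσ hσO a₀ ha₀ H hHK hHh M hM

/-! ## §2 The heads: `X₂(E_w)` is locally finite and `(q_v+1)`-regular -/

include hc hv in
/-- **REG2 AT THE PLACE — both letters at once**: for every vertex `x` of `X₂(E_w)`, `N(x)` is finite and `#N(x) = q_v + 1` (★ REG2 F2
`finite_neighborSet_latticeTree_two` ∕ `ncard_neighborSet_latticeTree_two_eq` fed with the place's `σO`, `σk`, `|𝓀| = q_v²`, `a₀`, and §1's transitivity).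
[cite: Serre1980Trees, II.1.1] [cite: BruhatTits1972, §10] [cite: NeukirchANT1999, Ch. II §4 Prop. (4.3)] -/
theorem finite_neighborSet_and_ncard_eq_latticeTree_two_inert {ϖ : w.1.adicCompletion E}
    (hd : HermitianLattice.UnramifiedLocalConjDatum (galAdicCompletionMap (L := E) c hw) ϖ)
    (x : {M : Submodule 𝒪[w.1.adicCompletion E] (Fin 2 → w.1.adicCompletion E) //
      IsSpecialLattice (galAdicCompletionMap (L := E) c hw) ϖ ((StdForm.antidiagonal 2).over (w.1.adicCompletion E)) M}) :
    ((latticeTree (galAdicCompletionMap (L := E) c hw) ϖ ((StdForm.antidiagonal 2).over (w.1.adicCompletion E))).neighborSet x).Finite ∧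
      ((latticeTree (galAdicCompletionMap (L := E) c hw) ϖ ((StdForm.antidiagonal 2).over (w.1.adicCompletion E))).neighborSet x).ncard =
        Nat.card (𝓞 F ⧸ v.asIdeal) + 1 := by
  -- the residual letters at the place (★ `UnitaryTwoTypeTwoEdgeCount` ll. 275–295 pattern)
  have hσO : ∀ y : 𝒪[w.1.adicCompletion E], galAdicCompletionMap (L := E) c hw y ∈ 𝒪[w.1.adicCompletion E] := mem_integer_galAdicCompletionMap c v w hw
  let σO : 𝒪[w.1.adicCompletion E] →+* 𝒪[w.1.adicCompletion E] :=
    ((galAdicCompletionMap (L := E) c hw).comp (𝒪[w.1.adicCompletion E]).subtype).codRestrict 𝒪[w.1.adicCompletion E] fun y => hσO y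
  have hσO' : ∀ y : 𝒪[w.1.adicCompletion E], ((σO y : 𝒪[w.1.adicCompletion E]) : w.1.adicCompletion E) = galAdicCompletionMap (L := E) c hw y := fun _ => rfl
  obtain ⟨σk, hσk⟩ := exists_residueField_ringHom_galAdicCompletionMap c v w hw
  have hτ : ∀ y : 𝒪[w.1.adicCompletion E], IsLocalRing.residue 𝒪[w.1.adicCompletion E] (σO y) = σk (IsLocalRing.residue 𝒪[w.1.adicCompletion E] y) := fun y => hσk y
  have hq : Nat.card 𝓀[w.1.adicCompletion E] = Nat.card (𝓞 F ⧸ v.asIdeal) ^ 2 := natCard_residueField_eq_sq_of_inert c v hc hv w hw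
  letI : Fintype 𝓀[w.1.adicCompletion E] := Fintype.ofFinite _
  have hq' : Fintype.card 𝓀[w.1.adicCompletion E] = Nat.card (𝓞 F ⧸ v.asIdeal) ^ 2 := by rw [← Nat.card_eq_fintype_card, hq]
  obtain ⟨a₀, ha₀⟩ := Literature.NumberTheory.LocalFields.UnramifiedQuadraticNorm.exists_isUnit_map_sub_of_residueHom_ne (galAdicCompletionMap (L := E) c hw) hσO σk hσk
    (Literature.LinearAlgebra.Matrix.exists_frob_ne hq' σk (residueHom_galAdicCompletionMap_eq_pow c v hc hv w hw σk hσO hσk))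
  have ha₀' : IsUnit (σO a₀ - a₀) := ha₀
  exact finite_neighborSet_and_ncard_eq_latticeTree_two hd σO hσO' ha₀' σk hτ hq (forall_isSelfDualLattice_exists_latt_eq_inert c hc v w hw hv) x

include hc hv in
/-- **(R.1) `hloc` AT THE PLACE**: every star of `X₂(E_w)` is finite (any `ϖ` with its unramified datum). [cite: BruhatTits1972, §10] [cite: Serre1980Trees, II.1.1] -/
theorem finite_neighborSet_latticeTree_two_inert {ϖ : w.1.adicCompletion E}
    (hd : HermitianLattice.UnramifiedLocalConjDatum (galAdicCompletionMap (L := E) c hw) ϖ)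
    (x : {M : Submodule 𝒪[w.1.adicCompletion E] (Fin 2 → w.1.adicCompletion E) //
      IsSpecialLattice (galAdicCompletionMap (L := E) c hw) ϖ ((StdForm.antidiagonal 2).over (w.1.adicCompletion E)) M}) :
    ((latticeTree (galAdicCompletionMap (L := E) c hw) ϖ ((StdForm.antidiagonal 2).over (w.1.adicCompletion E))).neighborSet x).Finite :=
  (finite_neighborSet_and_ncard_eq_latticeTree_two_inert c hc v w hw hv hd x).1

include hc hv in
/-- **(R.2) `hreg ∕ hdeg` AT THE PLACE — `#N(x) = q_v + 1`** at BOTH vertex types of `X₂(E_w)` (`q_v = |𝓞_F ∕ 𝔭_v|`; any `ϖ` with its unramified datum).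
[cite: Serre1980Trees, II.1.1] [cite: BruhatTits1972, §10] [cite: NeukirchANT1999, Ch. II §4 Prop. (4.3)] -/
theorem ncard_neighborSet_latticeTree_two_eq_inert {ϖ : w.1.adicCompletion E}
    (hd : HermitianLattice.UnramifiedLocalConjDatum (galAdicCompletionMap (L := E) c hw) ϖ)
    (x : {M : Submodule 𝒪[w.1.adicCompletion E] (Fin 2 → w.1.adicCompletion E) //
      IsSpecialLattice (galAdicCompletionMap (L := E) c hw) ϖ ((StdForm.antidiagonal 2).over (w.1.adicCompletion E)) M}) :
    ((latticeTree (galAdicCompletionMap (L := E) c hw) ϖ ((StdForm.antidiagonal 2).over (w.1.adicCompletion E))).neighborSet x).ncard =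
      Nat.card (𝓞 F ⧸ v.asIdeal) + 1 :=
  (finite_neighborSet_and_ncard_eq_latticeTree_two_inert c hc v w hw hv hd x).2

end InertPlace

end Summit.HodgeConjecture.HodgeConjecture.R90.S6

end
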